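import Summits.Ventures.HodgeRepro2.A2PontryaginLefschetz
import Summits.Ventures.HodgeRepro2.A2WeilProjectionPeriod

/-!
# The non-vanishing input (N) for the dual Lefschetz class (A2 annex, operator identity — part 8)

By the operator identity (`A2PontryaginLefschetz`), Theorem A's class `y = z ⋆ θ^k` is the
non-zero multiple `κ' • Λ^{n−k} z` of the dual Lefschetz class `Λ^{n−k} z`.  Row 97's criterion
(`weilProjModel_pontryagin_ne_zero_iff`: `p_W(y) ≠ 0 ⇔ ∃ σ, ∫_B z ∧ w_σ ≠ 0`) therefore holds for
`Λ^{n−k} z` as well (`weilProjModel_lam_pow_ne_zero_iff`), and the Weil coordinates of `Λ^{n−k} z`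
are `± (n−k)! c_{univ ∖ P₀}⁻¹ ∫_B z ∧ w_{P₀,!s}` (`repr_weilIndex_lam_pow`) — the factor
`c_{univ∖P₀}⁻¹` being the coefficient of the single surviving term `T = univ ∖ P₀` of the
multinomial expansion of `Λ^{n−k}`.
-/

namespace Summit.Ventures.HodgeRepro2.A2LamPowWeilPeriod

open WeilPlanes WeilIntegral WeilDetect WeilCoproduct A2HardLefschetzOps A2PontryaginModel
  A2WeilProjection A2WeilProjectionPeriod A2ModelDuality A2PontryaginLefschetz

variable {ι : Type*} [DecidableEq ι] [Fintype ι]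

/-- The Weil projection is `ℂ`-linear in the class (scalar multiples). -/
lemma weilProjModel_smul (W : Finset (Finset ι × Bool)) (r : ℂ) (x : A ι) :
    weilProjModel W (r • x) = r • weilProjModel W x := by
  simp only [weilProjModel, map_smul, Finsupp.smul_apply, smul_eq_mul, Finset.smul_sum, smul_smul]

/-- **`(N)` for the dual Lefschetz class**: for a family `W` of Weil data of common size `k ≥ 1`
and all `c_p ≠ 0`, `p_W(Λ^{n−k} z) ≠ 0 ⇔ ∃ σ ∈ W, ∫_B z ∧ w_σ ≠ 0`. -/
theorem weilProjModel_lam_pow_ne_zero_iff (W : Finset (Finset ι × Bool)) {k : ℕ} (hk1 : 1 ≤ k)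
    (hk : k ≤ Fintype.card ι) (hW : ∀ d ∈ W, d.1.card = k) {c : ι → ℂ} (hc : ∀ p, c p ≠ 0)
    (z : A ι) :
    weilProjModel W ((lam c ^ (Fintype.card ι - k)) z) ≠ 0 ↔
      ∃ d ∈ W, integral (z * weil d.1 !d.2) ≠ 0 := by
  rw [← weilProjModel_pontryagin_ne_zero_iff W k hk1 hW c hc z,
    pontryagin_theta_pow_eq_smul_lam_pow hc hk z, weilProjModel_smul, smul_ne_zero_iff]
  constructor
  · exact fun h => ⟨kappa'_ne_zero hc k, h⟩
  · exact fun h => h.2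

/-- **The Weil coordinates of the dual Lefschetz class**: the `w_{P₀,s}`-coordinate of
`Λ^{n−k} z`, `k = |P₀|`, is `± (n−k)!·(∏_{p ∉ P₀} c_p)⁻¹ · ∫_B z ∧ w_{P₀,!s}`. -/
theorem repr_weilIndex_lam_pow (P₀ : Finset ι) (s : Bool) {c : ι → ℂ} (hc : ∀ p, c p ≠ 0)
    (z : A ι) :
    ∃ ε : ℂ, (ε = 1 ∨ ε = -1) ∧
      (aBasis.repr ((lam c ^ (Fintype.card ι - P₀.card)) z)) (weilIndex P₀ s) =
        ε * ((((Fintype.card ι - P₀.card).factorial : ℂ) * (∏ p ∈ Finset.univ \ P₀, c p)⁻¹) *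
          integral (z * weil P₀ !s)) := by
  obtain ⟨ε, hε, h⟩ := repr_weilIndex_pontryagin P₀ s c hc z
  refine ⟨ε, hε, ?_⟩
  rw [pontryagin_theta_pow_eq_smul_lam_pow hc (Finset.card_le_univ P₀) z, map_smul,
    Finsupp.smul_apply, smul_eq_mul] at h
  have hκ : kappa' c P₀.card ≠ 0 := kappa'_ne_zero hc _
  have hprod : (∏ p ∈ Finset.univ \ P₀, c p) * ∏ p ∈ P₀, c p = ∏ p, c p :=
    Finset.prod_sdiff (Finset.subset_univ P₀)
  have hS0 : ∏ p ∈ Finset.univ \ P₀, c p ≠ 0 := Finset.prod_ne_zero_iff.2 fun p _ => hc p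
  have hfac : ((Fintype.card ι - P₀.card).factorial : ℂ) ≠ 0 := by
    exact_mod_cast Nat.factorial_ne_zero _
  have hvol := vol_ne_zero ι
  rw [← mul_right_inj' hκ, h, weilCoeffConstant, kappa', ← hprod]
  field_simp

end Summit.Ventures.HodgeRepro2.A2LamPowWeilPeriod
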